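import Literature.MathematicalPhysics.QuantumFieldTheory.Balaban1983to89.Node00.BackgroundActionT
import Literature.MathematicalPhysics.QuantumFieldTheory.Balaban1983to89.T4WilsonGaugeFlatDirection

/-!
# NODE N09 · [Balaban1987RG1] — GAUGE INVARIANCE OF THE EFFECTIVE ACTIONS `A_k` OVER A LIFT-COVARIANT TRANSPORT (p. 254 ∕ p. 263 ∕ (2.16)
# p. 269), and N09's Theorem-3 member composition input `HCompT` REDUCED TO THE [B11] INPUTS ALONE over such transports

T. Bałaban, *Renormalization group approach to lattice gauge field theories. I*, Commun. Math. Phys. **109** (1987) 249–301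
[Balaban1987RG1] (= [I]; PDF page = journal page − 248); [Balaban1985Variational] (= [B11], CMP 102) Thm 1 p. 279.  TRACK A (YM-PLAN
§2b, node N09 of 28), seat `pub-ymgap-dag-n09-a` (prover, KNIT-BY-NAME; HUMAN RULING D-0062).  THEOREMS ONLY, def-free, sorry-free,
standard axioms.  Companion of `B12NodeKnitRecord8` (N09's Theorem-3 member at the Stage-8 record), TRANSPORT-GENERIC like node00-def-B's
`Node00.BackgroundActionT`: everything below is stated for a transport family `T : Node00.Transport F N` (print's `T_k` of (0.13)∕(0.19),
whatever version a NODE 00 stage carries) and the effective actions `Node00.effActionHT F N T χ K g k` = (0.17)∕(0.19) `printedSeq` at `T`.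

THE PRINT.  p. 254: *«(Tρ)(V) = ∫dU t(V,U)ρ(U). (0.13) Here U, V are gauge field configurations on the lattices T, T⁽¹⁾ correspondingly,
and t(V,U) is a gauge invariant kernel […]. If ρ is a gauge invariant function, then Tρ is gauge invariant also.»*  p. 263: *«These
assumptions imply that the action A_k(U) defined on the space U_k(ε₀) […] is gauge invariant with respect to all G-valued
transformations.»*  p. 269: *«all the expressions in (2.12), together with the measure, are invariant with respect to the gauge
transformations U_{k+1} → U^u_{k+1}, […] (2.16) […] therefore the expression (2.13) is gauge invariant.»*  (`[…]` = omission by the author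
of this file.)

## WHAT THIS FILE PROVES (0 sorry; axioms {propext, Classical.choice, Quot.sound})

* §1 ONE STEP, ABSTRACT TRANSPORT: `gaugeInvariant_nextAction` — if `T` maps LIFT-invariant level-`j` densities (`B12RTGaugeInvariance254.LiftInvariant`:
  invariant under the block-constant lifts of the coarse gauge transformations) to gauge-invariant level-`(j+1)` densities, and `χ_j`, `GF_j`, `A_j`
  are lift-invariant, then `A_{j+1} = nextAction T χ_j GF_j g_j A_j` ((0.19) WITH BODY, `B12Eq019ActionBody.nextAction`) is gauge invariant — the
  proof of `B12Eq019ActionBody.nextAction_kernel_gaugeInvariant` with the kernel form replaced by the mapping property it uses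
  (`B12RTGaugeInvariance254.liftInvariant_sfDensity` for the fine density).
* §2 THE SEQUENCE: `gfOfRecord_liftInvariant` (the pinned gauge fixing of record `Node00.gfOfRecord` = `gaugeFixFn (contourOfRecord …) univ` is
  lift-invariant, `B12RTGaugeInvariance254.gaugeFixFn_gaugeAct_liftTransf`); **`gaugeInvariant_effActionHT`** — over a transport family with the
  mapping property at every step `j + 1 ≤ m + K` of the `K`-th torus and lift-invariant characteristic functions `χ K g j`, EVERY effective action
  `A_k = effActionHT F N T χ K g k`, `k ≤ m + K`, is gauge invariant (induction on `k` from `A_0 = −(1/g_0²)A^η`,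
  `T4WilsonGaugeFlatDirection.gaugeInvariant_wilsonExponent`) — p. 263's sentence as a theorem of the body.
* §3 THE COMPOSITION INPUT OF N09'S THEOREM-3 MEMBER: `hInvT_of_gaugeInvariant` — level-wise gauge invariance of `A_j`, `j < k`, gives
  `Node00.HInvT F N T χ K g k` (the residual-gauge invariance of `A_j ∘ Ū^j`, by the covariance of the iterated averages
  `B16Sect1Backgrounds.iter_gaugeAct`); `hInvT_of_liftCovariant` (all `k ≤ m + K`); hence **`hCompT_of_liftCovariant`**: `Node00.HCompT` from the
  [B11] inputs `HRestrict` + (1.1)-uniqueness at the intermediate levels ALONE (`Node00.hOrbit_of_hRestrict_of_unique`, `hCompT_of_hOrbit_of_hInvT`),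
  and **`indAOfRecordT_atRecord_of_liftCovariant`**: node00-def-B's (1.3)∕(0.23) at the record, `Node00.indAOfRecordT_atRecord`, with its
  composition input DISCHARGED — over a lift-covariant transport the format clause `IndAOfRecordT T …` at the record's own objects follows from
  χ-locality, the flow recursion `RGEqH`, and [B11] Thm 1 at the record's objects ((1.1) on the domain, `HRestrict`, intermediate uniqueness).
* §4 KERNEL-FORM TRANSPORTS (0.13) HAVE THE MAPPING PROPERTY: `liftCovariant_of_kernel` — a family of kernel transformations
  `B12FaddeevPopov016.KernelRT` with gauge-invariant kernels (`B12RTGaugeInvariance254.KernelGaugeInvariant`) maps lift-invariant densities to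
  gauge-invariant ones (`kernelRT_gaugeAct_of_liftInvariant`) — print's p. 254 sentence; so §2–§3 apply verbatim to any NODE 00 stage whose
  transport of record is a kernel family (R437 «₉ = represented tower»).

WHY THIS MATTERS FOR N09 (census `B12NodeKnitRecord8` §4∕§6): at the Stage-8 record the transport is `Node00.TOfRecord` — a CHOSEN VERSION of a
Radon–Nikodym derivative (`Node00.DatumAvLayer.TrhoOfRecord`), for which gauge invariance of `Tρ` holds only ALMOST EVERYWHERE
(`B12RTGaugeInvariance254.rtOpI_gaugeInvariant_ae`), so the middle composition clauses of (0.23) are point-value statements neither provable nor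
refutable at Stage 8 ([DAGN09A-G3-MIDDLE-CLAUSES-NOTE]); over a represented (kernel-form, or any lift-covariant) transport they are THEOREMS
by this file, and N09's Theorem-3 member then consumes [B11] Thm 1 at the record's objects and nothing else of the in-edges.
HONEST FRAMING: count-neutral kernel bookkeeping; the mapping property of `T`, the lift-invariance of `χ`, and the [B11] inputs are HYPOTHESES
(located: p. 254, (2.16) p. 269, [B11] Thm 1 p. 279); nothing of Bałaban's asserted beyond the cited algebra; no estimate; one finite four-torus
programme at fixed ε per run — NOT ℝ⁴, NOT infinite volume, NOT OS axioms, NOT a mass gap, NOT the Clay problem.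

v1.1 (append-only; v1 declarations byte-identical): §5 — THE COMPOSITION-FREE READING of (0.23): with the `j`-th term read along the FIXED minimiser
`U_k(V)` (print (0.24): «functions of U») instead of the re-minimised `U_{j+1}(Ū^{j+1}U_kV)`, the terms telescope from `iter_Uk` and `A_0 = −(1/g_0²)A^η`
alone (`sum_fixedTerm_eq`) and (0.23) at the record holds from the flow recursion and (1.1) solvability with NO composition ∕ invariance input
(`repr023_fixedTerm`) — the kernel form of repair (R-T2): a format predicate reading its terms this way has no point-value composition clause at all.
-/

noncomputable section

namespace Literature.MathematicalPhysics.QuantumFieldTheory.Balaban1983to89.B12EffectiveActionInvarianceT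

open Node00 T4Continuum
open FlowStep (HBeta prefixOf RGEqH)
open FlowStepRuns (genSeq)
open T4FlagMemory (extd)
open B12Eq019ActionBody (nextAction nextAction_apply integrand_eq)
open B12RTGaugeInvariance254 (LiftInvariant liftInvariant_of_gaugeInvariant liftInvariant_sfDensity KernelGaugeInvariant)
open GaugeField (GaugeInvariant)

/-! ## §1. One step (0.19), abstract transport: lift-invariant data ⇒ gauge-invariant `A_{j+1}` -/

section Step

variable {P : Params} {G : Type*} [GaugeGroup G] {j : ℕ}

/-- **p. 254 «If ρ is a gauge invariant function, then Tρ is gauge invariant also» ⇒ (0.19) is gauge invariant** — for ANY transport `T`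
with the mapping property «lift-invariant ⇒ gauge invariant» at level `j`, and lift-invariant `χ_j`, `GF_j`, `A_j`, the action
`A_{j+1}(V) = log 𝐍_j⁻¹ (T(χ_j e^{−GF_j/g_j² + A_j}))(V)` is invariant under all gauge transformations of `T⁽ʲ⁺¹⁾` (the fine density is
lift-invariant by `liftInvariant_sfDensity`; `𝐍_j` does not see `V`). [cite: Balaban1987RG1, (0.13) p.254 and (0.19) p.255] -/
theorem gaugeInvariant_nextAction {T : Density P j G → Density P (j + 1) G}
    (hT : ∀ ρ : Density P j G, LiftInvariant ρ → GaugeInvariant (T ρ)) {χ GF A : Density P j G}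
    (hχ : LiftInvariant χ) (hGF : LiftInvariant GF) (hA : LiftInvariant A) (gk : ℝ) :
    GaugeInvariant (nextAction T χ GF gk A) := by
  intro v V
  rw [nextAction_apply, nextAction_apply, integrand_eq, hT _ (liftInvariant_sfDensity hχ hGF hA gk) v V]

end Step

/-! ## §2. The sequence `A_0, A_1, …` over a transport family (p. 263: «the action A_k(U) … is gauge invariant») -/

variable (F : T4Family) (N : ℕ) [NeZero N]

/-- The pinned gauge fixing of record `GF_j = gaugeFixFn (contourOfRecord K j) univ` is lift-invariant (`Re tr (hgh⁻¹) = Re tr g` along the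
block-constant lifts; `B12RTGaugeInvariance254.gaugeFixFn_gaugeAct_liftTransf`), in the standing range `j + 1 ≤ m + K`. [cite: Balaban1987RG1, (0.17) p.255] -/
theorem gfOfRecord_liftInvariant (K : ℕ) {j : ℕ} (hj : j + 1 ≤ (F.P K).m + (F.P K).K) :
    LiftInvariant (gfOfRecord F N K j) :=
  fun v U => B12RTGaugeInvariance254.gaugeFixFn_gaugeAct_liftTransf hj (contourOfRecord F N K j) Finset.univ v U

/-- **THE EFFECTIVE ACTIONS ARE GAUGE INVARIANT** (p. 263, as a theorem of the body (0.17)∕(0.19)): over a transport family `T` with the mapping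
property «lift-invariant ⇒ gauge invariant» at every step `j + 1 ≤ m + K` of the `K`-th torus, and characteristic functions `χ K g j`
lift-invariant at those steps, every `A_k = effActionHT F N T χ K g k` with `k ≤ m + K` satisfies `A_k(V^v) = A_k(V)` for all gauge
transformations `v` of `T⁽ᵏ⁾` — by induction: `A_0 = −(1/g_0²)A^η` (`T4WilsonGaugeFlatDirection.gaugeInvariant_wilsonExponent`), step §1 with
`gfOfRecord_liftInvariant` and `liftInvariant_of_gaugeInvariant`. [cite: Balaban1987RG1, p.263 («the action A_k(U) … is gauge invariant») and (0.13) p.254] -/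
theorem gaugeInvariant_effActionHT (T : Transport F N)
    (hT : ∀ K j, j + 1 ≤ (F.P K).m + (F.P K).K → ∀ ρ : Density (F.P K) j (SU N), LiftInvariant ρ → GaugeInvariant (T K j ρ))
    (χ : (K : ℕ) → (ℕ → ℝ) → (k : ℕ) → Density (F.P K) k (SU N)) (K : ℕ) (g : ℕ → ℝ)
    (hχ : ∀ j, j + 1 ≤ (F.P K).m + (F.P K).K → LiftInvariant (χ K g j)) :
    ∀ k, k ≤ (F.P K).m + (F.P K).K → GaugeInvariant (effActionHT F N T χ K g k) := by
  intro k
  induction k with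
  | zero =>
    intro _
    rw [effActionHT_zero]
    exact T4WilsonGaugeFlatDirection.gaugeInvariant_wilsonExponent _ _
  | succ k ih =>
    intro hk
    rw [effActionHT_succ]
    exact gaugeInvariant_nextAction (hT K k hk) (hχ k hk) (gfOfRecord_liftInvariant F N K hk)
      (liftInvariant_of_gaugeInvariant (ih (Nat.le_of_succ_le hk))) (g k)

/-! ## §3. N09's composition input over such transports: `HInvT`, `HCompT`, and (1.3)∕(0.23) at the record from the [B11] inputs alone -/

/-- **`HInvT` FROM LEVEL-WISE GAUGE INVARIANCE**: if `A_j` is gauge invariant on `T⁽ʲ⁾` for every `j < k` (`k ≤ m + K`), then `A_j ∘ Ū^j` is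
invariant under every level-0 gauge transformation — in particular under the residual ones of level `j+1` — by the covariance of the iterated
averages `Ū^j(U^u) = (Ū^j U)^{u↾T⁽ʲ⁾}` (`B16Sect1Backgrounds.iter_gaugeAct`). [cite: Balaban1987RG1, (0.21) p.256 and (2.16) p.269] -/
theorem hInvT_of_gaugeInvariant (T : Transport F N) (χ : (K : ℕ) → (ℕ → ℝ) → (k : ℕ) → Density (F.P K) k (SU N)) (K : ℕ)
    (g : ℕ → ℝ) {k : ℕ} (hk : k ≤ (F.P K).m + (F.P K).K) (hinv : ∀ j < k, GaugeInvariant (effActionHT F N T χ K g j)) :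
    HInvT F N T χ K g k := by
  intro j hj u _ U
  rw [B16Sect1Backgrounds.iter_gaugeAct (avOfRecord F N K) u U j ((le_of_lt hj).trans hk)]
  exact hinv j hj (B16Sect1Backgrounds.toMS u j) _

/-- **`HInvT` AT EVERY LEVEL OVER A LIFT-COVARIANT TRANSPORT** with lift-invariant `χ` (§2 + `hInvT_of_gaugeInvariant`).
[cite: Balaban1987RG1, p.263 and (2.16) p.269] -/
theorem hInvT_of_liftCovariant (T : Transport F N)
    (hT : ∀ K j, j + 1 ≤ (F.P K).m + (F.P K).K → ∀ ρ : Density (F.P K) j (SU N), LiftInvariant ρ → GaugeInvariant (T K j ρ))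
    (χ : (K : ℕ) → (ℕ → ℝ) → (k : ℕ) → Density (F.P K) k (SU N)) (K : ℕ) (g : ℕ → ℝ)
    (hχ : ∀ j, j + 1 ≤ (F.P K).m + (F.P K).K → LiftInvariant (χ K g j)) {k : ℕ} (hk : k ≤ (F.P K).m + (F.P K).K) :
    HInvT F N T χ K g k :=
  hInvT_of_gaugeInvariant F N T χ K g hk fun j hj => gaugeInvariant_effActionHT F N T hT χ K g hχ j ((le_of_lt hj).trans hk)

/-- **THE COMPOSITION INPUT `HCompT` OF (0.23) FROM THE [B11] INPUTS ALONE over a lift-covariant transport**: `HRestrict` ([B11] Thm 1 (8)–(10): the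
global minimiser restricts) + (1.1)-uniqueness at the intermediate levels on the averaged minimisers ⇒ `HOrbit` (`Node00.hOrbit_of_hRestrict_of_unique`)
⇒ with `HInvT` a theorem (this §) ⇒ `HCompT` (`Node00.hCompT_of_hOrbit_of_hInvT`).  Domains at levels `k ≤ K` of a run on the `K`-th torus.
[cite: Balaban1987RG1, (0.21)–(0.23) p.256, (1.1) p.260; Balaban1985Variational, Thm 1 (8)–(10) p.279] -/
theorem hCompT_of_liftCovariant (T : Transport F N)
    (hT : ∀ K j, j + 1 ≤ (F.P K).m + (F.P K).K → ∀ ρ : Density (F.P K) j (SU N), LiftInvariant ρ → GaugeInvariant (T K j ρ))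
    (χ : (K : ℕ) → (ℕ → ℝ) → (k : ℕ) → Density (F.P K) k (SU N)) {ε : ℝ} (K : ℕ) (g : ℕ → ℝ)
    (hχ : ∀ j, j + 1 ≤ (F.P K).m + (F.P K).K → LiftInvariant (χ K g j)) {k : ℕ} (hk : k ≤ K)
    {dom : Set (GaugeField (F.P K) k (SU N))} (hres : HRestrict F N ε K k dom)
    (huniq : ∀ V ∈ dom, ∀ j < k, UniqueUkOrbit F N K (j + 1) ε (Averaging.iter (avOfRecord F N K) (j + 1) (Uk F N K k ε V))) :
    HCompT F N T χ ε K g k dom :=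
  hCompT_of_hOrbit_of_hInvT F N T χ (hOrbit_of_hRestrict_of_unique F N hres huniq)
    (hInvT_of_liftCovariant F N T hT χ K g hχ (hk.trans (Nat.le_add_left _ _)))

/-- **(1.3)∕(0.23) AT THE RECORD OVER A LIFT-COVARIANT TRANSPORT, COMPOSITION INPUT DISCHARGED**: node00-def-B's `Node00.indAOfRecordT_atRecord` with
`hcomp` supplied by `hCompT_of_liftCovariant` — the format clause `IndAOfRecordT T …` at the record's own history, domain, action, background action
and expansion term follows from χ-locality in the couplings, the flow recursion (0.20) up to `k`, and [B11] Thm 1 at the record's objects ((1.1) on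
the domain, `HRestrict`, intermediate uniqueness) — NO invariance hypothesis left.  This is N09's Theorem-3 member input at any NODE 00 stage whose
transport of record has the mapping property (not Stage 8's RN-version transport). [cite: Balaban1987RG1, (1.1)–(1.3) p.260, (0.22)–(0.23) p.256, p.263 and (2.16) p.269] -/
theorem indAOfRecordT_atRecord_of_liftCovariant (T : Transport F N)
    (hT : ∀ K j, j + 1 ≤ (F.P K).m + (F.P K).K → ∀ ρ : Density (F.P K) j (SU N), LiftInvariant ρ → GaugeInvariant (T K j ρ))
    (χ : (K : ℕ) → (ℕ → ℝ) → (k : ℕ) → Density (F.P K) k (SU N)) (ε : ℝ) (β : HBeta) (p : B12.RunParams) (k : ℕ) (hk : k ≤ p.K)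
    (dom : Set (GaugeField (F.P p.K) k (SU N)))
    (hχinv : ∀ j, j + 1 ≤ (F.P p.K).m + (F.P p.K).K → LiftInvariant (χ p.K (genSeq β p.g0) j))
    (hχ : ∀ n ≤ k, χ p.K (extd (prefixOf (genSeq β p.g0) k)) n = χ p.K (genSeq β p.g0) n)
    (hflow : RGEqH k β (genSeq β p.g0))
    (h11 : ∀ V ∈ dom, UkExists F N p.K k ε V ∧ UniqueUkOrbit F N p.K k ε V)
    (hres : HRestrict F N ε p.K k dom)
    (huniq : ∀ V ∈ dom, ∀ j < k, UniqueUkOrbit F N p.K (j + 1) ε (Averaging.iter (avOfRecord F N p.K) (j + 1) (Uk F N p.K k ε V))) :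
    IndAOfRecordT F N T χ ε β p k (prefixOf (genSeq β p.g0) k) dom
      (effActionOfRecordT F N T χ β p k) (wilsonBGOfRecord F N ε p k) (EkOfRecordT F N T χ ε β p k) :=
  indAOfRecordT_atRecord F N T χ ε β p k dom hχ hflow h11
    (hCompT_of_liftCovariant F N T hT χ p.K (genSeq β p.g0) hχinv hk hres huniq)

/-! ## §4. Kernel-form transformations (0.13) with gauge-invariant kernels have the mapping property (p. 254) -/

/-- **p. 254 FOR A KERNEL FAMILY**: if `T K j = (kr K j).T` is the kernel transformation (0.13) `(Tρ)(V) = ∫dU t(V,U)ρ(U)` of a family of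
gauge-invariant kernels (`KernelGaugeInvariant`), then `T` maps lift-invariant densities to gauge-invariant densities at every step
`j + 1 ≤ m + K` (`B12RTGaugeInvariance254.kernelRT_gaugeAct_of_liftInvariant`), so §2–§3 apply to it verbatim. [cite: Balaban1987RG1, (0.13) p.254] -/
theorem liftCovariant_of_kernel
    (kr : (K j : ℕ) → B12FaddeevPopov016.KernelRT (F.P K) j (SU N)) (hkr : ∀ K j, KernelGaugeInvariant (kr K j))
    (T : Transport F N) (hTkr : ∀ K j, T K j = (kr K j).T) :
    ∀ K j, j + 1 ≤ (F.P K).m + (F.P K).K → ∀ ρ : Density (F.P K) j (SU N), LiftInvariant ρ → GaugeInvariant (T K j ρ) := by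
  intro K j hj ρ hρ v V
  rw [hTkr K j]
  exact B12RTGaugeInvariance254.kernelRT_gaugeAct_of_liftInvariant hj (hkr K j) hρ v V

/-- Hence over a kernel family with gauge-invariant kernels and lift-invariant `χ`: every `A_k`, `k ≤ m + K`, is gauge invariant, and `HInvT` holds at
every level `k ≤ m + K`. [cite: Balaban1987RG1, (0.13) p.254, p.263 and (2.16) p.269] -/
theorem hInvT_of_kernel
    (kr : (K j : ℕ) → B12FaddeevPopov016.KernelRT (F.P K) j (SU N)) (hkr : ∀ K j, KernelGaugeInvariant (kr K j))
    (T : Transport F N) (hTkr : ∀ K j, T K j = (kr K j).T)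
    (χ : (K : ℕ) → (ℕ → ℝ) → (k : ℕ) → Density (F.P K) k (SU N)) (K : ℕ) (g : ℕ → ℝ)
    (hχ : ∀ j, j + 1 ≤ (F.P K).m + (F.P K).K → LiftInvariant (χ K g j)) {k : ℕ} (hk : k ≤ (F.P K).m + (F.P K).K) :
    HInvT F N T χ K g k :=
  hInvT_of_liftCovariant F N T (liftCovariant_of_kernel F N kr hkr T hTkr) χ K g hχ hk

/-! ## §5 (v1.1, append-only). THE COMPOSITION-FREE READING OF (0.23): the terms read ALONG THE FIXED MINIMISER `U_k(V)` telescope with NO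
`HCompT` ∕ invariance input — repair (R-T2) of [DAGN09A-G3-KERNEL-TRANSPORT-NOTE] in kernel form (any transport, any χ) -/

/-- **THE FIXED-MINIMISER TERMS TELESCOPE** (any transport `T`, any `χ`): with the `j`-th term read along the fixed fine configuration
`U := U_k(V)` — `A_{j+1}(Ū^{j+1}U) − A_j(Ū^jU)` — instead of along the re-minimised `U_{j+1}(Ū^{j+1}U)` (def-B's `mergedTermT`), the sum over
`j < k` is `A_k(V) + (1/g_0²)·A^η(U_k V)` from `Ū^k(U_k V) = V` ((1.1) solvability, `iter_Uk`) and `A_0 = −(1/g_0²)A^η` ALONE: the `hcomp` input of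
`Node00.sum_mergedTermT_eq` disappears.  (Print, (0.24) p. 257: the terms are «functions of U», `U = U_k(V)`.) [cite: Balaban1987RG1, (0.22)–(0.24) pp.256–257] -/
theorem sum_fixedTerm_eq (T : Transport F N) (χ : (K : ℕ) → (ℕ → ℝ) → (k : ℕ) → Density (F.P K) k (SU N)) (ε : ℝ) {K : ℕ}
    (g : ℕ → ℝ) {k : ℕ} {V : GaugeField (F.P K) k (SU N)} (hk : UkExists F N K k ε V) :
    ∑ j ∈ Finset.range k,
        (effActionHT F N T χ K g (j + 1) (Averaging.iter (avOfRecord F N K) (j + 1) (Uk F N K k ε V)) -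
          effActionHT F N T χ K g j (Averaging.iter (avOfRecord F N K) j (Uk F N K k ε V))) =
      effActionHT F N T χ K g k V + (1 / (g 0) ^ 2) * wilsonAction4 (Uk F N K k ε V) := by
  rw [Finset.sum_range_sub (fun j => effActionHT F N T χ K g j (Averaging.iter (avOfRecord F N K) j (Uk F N K k ε V))) k,
    iter_Uk hk]
  show effActionHT F N T χ K g k V - B12Eq019ActionBody.wilsonTerm (g 0) 1 (Uk F N K k ε V) = _
  rw [B12Eq019ActionBody.wilsonTerm]
  unfold wilsonAction4
  ring

/-- **(0.23) AT THE RECORD IN THE COMPOSITION-FREE READING** (any transport `T`, any `χ`): along a history obeying the flow recursion (0.20) up to `k`,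
for every `V` at which the level-`k` problem is solvable,
`𝐄_k(V) = Σ_{j<k} [ −β_{j+1}(g_0,…,g_j)·A^η(U_k V) + (A_{j+1}(Ū^{j+1}U_kV) − A_j(Ū^jU_kV)) ]`
with `𝐄_k := A_k + (1/g_k²)A^η(U_k ·)` ((0.22) as definition, `Node00.EkOfRecordT`) — from `sum_fixedTerm_eq` and the coupling telescope
`Σ_{j<k} β_{j+1} = 1/g_0² − 1/g_k²` (`Node00.sum_beta_eq_of_rgEqH`); NO domain, NO `HCompT`, NO gauge-invariance input.  The identity a NODE 00
format predicate obtains for free if it reads the (0.23) terms along the fixed minimiser. [cite: Balaban1987RG1, (0.20) p.256 and (0.22)–(0.24) pp.256–257] -/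
theorem repr023_fixedTerm (T : Transport F N) (χ : (K : ℕ) → (ℕ → ℝ) → (k : ℕ) → Density (F.P K) k (SU N)) (ε : ℝ) (β : HBeta)
    (p : B12.RunParams) {k : ℕ} (hflow : RGEqH k β (genSeq β p.g0)) {V : GaugeField (F.P p.K) k (SU N)}
    (hk : UkExists F N p.K k ε V) :
    EkOfRecordT F N T χ ε β p k V =
      ∑ j ∈ Finset.range k,
        (-(β j (prefixOf (genSeq β p.g0) j)) * wilsonBGOfRecord F N ε p k V +
          (effActionHT F N T χ p.K (genSeq β p.g0) (j + 1)
              (Averaging.iter (avOfRecord F N p.K) (j + 1) (Uk F N p.K k ε V)) -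
            effActionHT F N T χ p.K (genSeq β p.g0) j (Averaging.iter (avOfRecord F N p.K) j (Uk F N p.K k ε V)))) := by
  rw [Finset.sum_add_distrib, sum_fixedTerm_eq F N T χ ε (genSeq β p.g0) hk, ← Finset.sum_mul, Finset.sum_neg_distrib,
    sum_beta_eq_of_rgEqH hflow]
  unfold EkOfRecordT effActionOfRecordT wilsonBGOfRecord
  ring

end Literature.MathematicalPhysics.QuantumFieldTheory.Balaban1983to89.B12EffectiveActionInvarianceT

end
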